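import Summits.QuantumFields.YangMills.Theorems.LuscherReductionDressedRitzLiftPositionCouplingSlowStiff
import Summits.QuantumFields.YangMills.Theorems.LuscherReductionDressedRitzPolyakovLiftUniversalityExists
import HarnessLib

/-!
# Route `LuscherReduction`, item `DressedRitz` (stmt-QuantumFields-20205), line «polyakovlift» r5 — the SLOW/STIFF press-button for S-PSCAL's position
# clause (o5′): same-operator level pinning from an eigenfamily budget (lane W1-A plumbing)

Support module (LEAD prover ym-lead-20205-polyakovlift g0; `--supports stmt-QuantumFields-20205`, helper).  The S-POS press-button
`LiftPos.coreO5_of_slow_stiff` (`…LiftPositionSlowStiff.lean`) hard-wires the FINE setting (reference levels `μ_{i+1}(B)·λ₀(β)` across two operators).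
S-PSCAL (`PScalingExistsAt k`, clause (o5′)) pins the Rayleigh quotient of a shadow vector `w_i` under the one-site operator `K_B` to a level `μ_{i+1}(B)` of
the SAME operator.  This file states the pinch abstractly — any lattice size `M`, coupling `B`, reference value `ν`, tolerance exponents `a₁, a₂` — so that
W1-A instantiates it at `M = 1`, `B = 2L³/Λ³`, `ν = levelValue su2Rep 1 B (i+1)`, `a₁ = C₁Λ²/L`, `a₂ = C₂Λ²/L`:

* `samePinch_of_slow_stiff` — from an `l2`-orthonormal exact eigenfamily `ψ` of `K_B`, a pivot `κ ∈ [0, μ₀]` with `κ ≤ e^{a₁}ν`, `ν ≤ e^{a₁}κ`, and the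
  SLOW/STIFF BUDGET `Σ_j |ev_j − κ|⟨w,ψ_j⟩² + μ₀‖w − Σ_j⟨w,ψ_j⟩ψ_j‖² ≤ (1 − e^{−a₂})κ‖w‖²` (generic `LiftPos.position_defect_le`), conclude the two-sided
  (o5′)-format pinning `⟨w,K_Bw⟩·μ₀ ≤ e^{a₁+a₂}(ν·μ₀)‖w‖²`, `ν·μ₀‖w‖² ≤ e^{a₁+a₂}⟨w,K_Bw⟩·μ₀`;
* `pscalO5_of_slow_stiff` — the family version in the exact format of the (o5′) conjunct of `PScalingExistsAt` (`B = 2L³/Λ³`, constant `C₁ + C₂`).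
(o6′) needs no new press-button: `LiftPos.coupling_defect_le` is generic — at `M = 1`, coupling `B`, its top value is `μ₀(B)`, the factor in (o6′).

HONEST FRAMING: Rayleigh-quotient algebra on a fixed lattice (conditional femto rung R2b1); the budget (eigenvector control of the shadow insertions — ONE-type
semiclassics in two couplings, `PSCAL-LEADING-ORDER.md`) is the OPEN content of S-PSCAL; nothing here bears on infinite volume, the continuum limit or the Clay
gap.  References: M. Lüscher, NPB 219 (1983) 233 [cite: Luscher1983, §3]; T. Kato, Perturbation Theory for Linear Operators (1966), §V.4 [cite: Kato1966, §V.4].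
-/

set_option autoImplicit false

noncomputable section

open MeasureTheory Filter Topology Real
open Literature.MathematicalPhysics.QuantumFieldTheory (GaugeConfig Site gaugeTransform)
open scoped BigOperators

namespace Summit.QuantumFields.YangMills.Theorems.FemtoTransferGap.PolyakovLift

open Summit.QuantumFields.YangMills.Theorems.FemtoTransferGap
open Summit.QuantumFields.YangMills.Theorems.FemtoTransferGap.LiftPos

/-- ★ **Same-operator pinch from a slow/stiff budget.**  On any lattice `M` with coupling `B ≥ 0`: an exact `l2`-orthonormal eigenfamily `ψ`, a pivot
`κ ∈ [0, μ₀]` two-sidedly `e^{a₁}`-close to the reference `ν`, and the budget `Σ|ev_j − κ|⟨w,ψ_j⟩² + μ₀‖r‖² ≤ (1 − e^{−a₂})κ‖w‖²` give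
`⟨w,K_Bw⟩μ₀ ≤ e^{a₁+a₂}(νμ₀)‖w‖²` and `νμ₀‖w‖² ≤ e^{a₁+a₂}⟨w,K_Bw⟩μ₀`. [cite: Kato1966, §V.4] -/
theorem samePinch_of_slow_stiff {M : ℕ} [NeZero M] {B : ℝ} (hB : 0 ≤ B) {w : GaugeConfig 3 M SU2 → ℝ} (hw : IsPhys w) (ν a₁ a₂ : ℝ)
    {N : ℕ} {ψ : Fin N → (GaugeConfig 3 M SU2 → ℝ)} (hψ : ∀ j, IsPhys (ψ j)) (hon : ∀ i l, l2 (ψ i) (ψ l) = if i = l then 1 else 0)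
    (ev : Fin N → ℝ) (heig : ∀ j, transferApply B (ψ j) = ev j • ψ j) {κ : ℝ} (hκ0 : 0 ≤ κ) (hκ1 : κ ≤ levelValue su2Rep M B 0)
    (hA : κ ≤ Real.exp a₁ * ν) (hB' : ν ≤ Real.exp a₁ * κ)
    (hbudget : ∑ j, |ev j - κ| * l2 w (ψ j) ^ 2 +
        levelValue su2Rep M B 0 * l2 (w - ∑ j, l2 w (ψ j) • ψ j) (w - ∑ j, l2 w (ψ j) • ψ j) ≤
      (1 - Real.exp (-a₂)) * (κ * l2 w w)) :
    l2 w (transferApply B w) * levelValue su2Rep M B 0 ≤ Real.exp (a₁ + a₂) * (ν * levelValue su2Rep M B 0) * l2 w w ∧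
      ν * levelValue su2Rep M B 0 * l2 w w ≤ Real.exp (a₁ + a₂) * (l2 w (transferApply B w) * levelValue su2Rep M B 0) := by
  set d := l2 w (transferApply B w) with hd
  set n := l2 w w with hn
  set m0 := levelValue su2Rep M B 0 with hm0
  set E₁ := Real.exp a₁ with hE₁
  set E₂ := Real.exp a₂ with hE₂
  set E₂' := Real.exp (-a₂) with hE₂'
  have hm0pos : 0 ≤ m0 := levelValue_su2Rep_nonneg M hB 0
  have hE1 : 0 < E₁ := Real.exp_pos _
  have hE2 : 0 < E₂ := Real.exp_pos _
  have hexp : Real.exp (a₁ + a₂) = E₁ * E₂ := by rw [hE₁, hE₂, ← Real.exp_add]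
  have hinv : E₂ * E₂' = 1 := by rw [hE₂, hE₂', ← Real.exp_add, add_neg_cancel, Real.exp_zero]
  have h2 : 2 - E₂' ≤ E₂ := two_sub_exp_neg_le_exp _
  have hn0 : 0 ≤ n := l2_self_nonneg _
  have hκn : 0 ≤ κ * n := mul_nonneg hκ0 hn0
  have hdef : |d - κ * n| ≤ (1 - E₂') * (κ * n) := (position_defect_le hB hψ hon ev heig hw hκ0 hκ1).trans hbudget
  rw [abs_le] at hdef
  obtain ⟨hlow, hupp⟩ := hdef
  have hdlo : E₂' * (κ * n) ≤ d := by nlinarith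
  have hdhi : d ≤ E₂ * (κ * n) := by nlinarith
  rw [hexp]
  constructor
  · calc d * m0 ≤ E₂ * (κ * n) * m0 := mul_le_mul_of_nonneg_right hdhi hm0pos
      _ = E₂ * (n * m0) * κ := by ring
      _ ≤ E₂ * (n * m0) * (E₁ * ν) := mul_le_mul_of_nonneg_left hA (mul_nonneg hE2.le (mul_nonneg hn0 hm0pos))
      _ = E₁ * E₂ * (ν * m0) * n := by ring
  · have hk : κ * n ≤ E₂ * d := by
      have h1 : E₂ * (E₂' * (κ * n)) ≤ E₂ * d := mul_le_mul_of_nonneg_left hdlo hE2.le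
      calc κ * n = E₂ * E₂' * (κ * n) := by rw [hinv, one_mul]
        _ = E₂ * (E₂' * (κ * n)) := by ring
        _ ≤ E₂ * d := h1
    calc ν * m0 * n ≤ E₁ * κ * m0 * n := by
          have := mul_le_mul_of_nonneg_right hB' (mul_nonneg hm0pos hn0)
          calc ν * m0 * n = ν * (m0 * n) := by ring
            _ ≤ E₁ * κ * (m0 * n) := this
            _ = E₁ * κ * m0 * n := by ring
      _ = E₁ * m0 * (κ * n) := by ring
      _ ≤ E₁ * m0 * (E₂ * d) := mul_le_mul_of_nonneg_left hk (mul_nonneg hE1.le hm0pos)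
      _ = E₁ * E₂ * (d * m0) := by ring

/-- ★ **(o5′) of `PScalingExistsAt` from slow/stiff budgets**, family version in the stub's format: one-site lattice, `B = 2L³/Λ³`, references
`μ_{i+1}(B)`, tolerances `e^{C₁Λ²/L}` (pivot vs level) and `1 − e^{−C₂Λ²/L}` (budget); conclusion with constant `C₁ + C₂`. [cite: Luscher1983, §3] -/
theorem pscalO5_of_slow_stiff {k : ℕ} (C₁ C₂ : ℝ) {L : ℕ} {Λ : ℝ} (hB : 0 ≤ 2 * (L : ℝ) ^ 3 / Λ ^ 3)
    {w : Fin k → (GaugeConfig 3 1 SU2 → ℝ)} (hw : ∀ i, IsPhys (w i))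
    (h : ∀ i : Fin k, ∃ (N : ℕ) (ψ : Fin N → (GaugeConfig 3 1 SU2 → ℝ)) (ev : Fin N → ℝ) (κ : ℝ),
      (∀ j, IsPhys (ψ j)) ∧ (∀ j l, l2 (ψ j) (ψ l) = if j = l then 1 else 0) ∧
      (∀ j, transferApply (2 * (L : ℝ) ^ 3 / Λ ^ 3) (ψ j) = ev j • ψ j) ∧ 0 ≤ κ ∧
      κ ≤ levelValue su2Rep 1 (2 * (L : ℝ) ^ 3 / Λ ^ 3) 0 ∧
      κ ≤ Real.exp (C₁ * Λ ^ 2 / L) * levelValue su2Rep 1 (2 * (L : ℝ) ^ 3 / Λ ^ 3) ((i : ℕ) + 1) ∧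
      levelValue su2Rep 1 (2 * (L : ℝ) ^ 3 / Λ ^ 3) ((i : ℕ) + 1) ≤ Real.exp (C₁ * Λ ^ 2 / L) * κ ∧
      ∑ j, |ev j - κ| * l2 (w i) (ψ j) ^ 2 +
          levelValue su2Rep 1 (2 * (L : ℝ) ^ 3 / Λ ^ 3) 0 * l2 (w i - ∑ j, l2 (w i) (ψ j) • ψ j) (w i - ∑ j, l2 (w i) (ψ j) • ψ j) ≤
        (1 - Real.exp (-(C₂ * Λ ^ 2 / L))) * (κ * l2 (w i) (w i))) :
    let B : ℝ := 2 * (L : ℝ) ^ 3 / Λ ^ 3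
    let m0 := levelValue su2Rep 1 B 0
    ∀ i : Fin k,
      l2 (w i) (transferApply B (w i)) * m0 ≤ Real.exp ((C₁ + C₂) * Λ ^ 2 / L) * (levelValue su2Rep 1 B ((i : ℕ) + 1) * m0) * l2 (w i) (w i) ∧
      levelValue su2Rep 1 B ((i : ℕ) + 1) * m0 * l2 (w i) (w i) ≤ Real.exp ((C₁ + C₂) * Λ ^ 2 / L) * (l2 (w i) (transferApply B (w i)) * m0) := by
  intro B m0 i
  obtain ⟨N, ψ, ev, κ, hψ, hon, heig, hκ0, hκ1, hA, hB', hbudget⟩ := h i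
  have hsum : (C₁ + C₂) * Λ ^ 2 / L = C₁ * Λ ^ 2 / L + C₂ * Λ ^ 2 / L := by ring
  rw [hsum]
  exact samePinch_of_slow_stiff hB (hw i) _ _ _ hψ hon ev heig hκ0 hκ1 hA hB' hbudget

end Summit.QuantumFields.YangMills.Theorems.FemtoTransferGap.PolyakovLift

end
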